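import Summits.Ventures.PercRepro.C041TriangleLeafMarkStar3MarkA
import Summits.Ventures.PercRepro.C041TriangleLeafMarkStar3MarkB
import Summits.Ventures.PercRepro.C041TriangleLeafMarkStar3MarkC
import Summits.Ventures.PercRepro.C041TriangleLeafMarkStar3MarkD
import Summits.Ventures.PercRepro.C041TriangleLeafMarkStar3MarkE
import Summits.Ventures.PercRepro.C041TriangleLeafMarkStar3MarkF
import Summits.Ventures.PercRepro.C041TriangleLeafMarkStar3MarkG
import Summits.Ventures.PercRepro.C041TriangleLeafMarkStar3MarkH

/-!
# THEOREM (LEAF + MARK × THREE LEAVES + MARK) — coordinate 5 of the identity `θ_△(v d * v 1, v a * v b * v c * v 1) = leafMarkStar3MarkA a b c d + leafMarkStar3MarkB a b c d + leafMarkStar3MarkC a b c d + leafMarkStar3MarkD a b c d + leafMarkStar3MarkE a b c d + leafMarkStar3MarkF a b c d + leafMarkStar3MarkG a b c d + leafMarkStar3MarkH a b c d` (mine-3, gen 67; C-041.md §21 (bg)): the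
explicit certificate's coordinate 5 agrees with the triangle map's, by `ring` over the parts' definitions (one
coordinate per module: the six expansions of 1446 terms each exceed one farm node together).
-/

namespace PercRepro

namespace RelaxedTriangle

open TreeClosure

set_option maxHeartbeats 800000 in
/-- Coordinate 5 of the identity. -/
theorem thetaTri_leafMarkStar3Mark_coord5 (a b c d : ℝ) :
    thetaTri (v d * v 1) (v a * v b * v c * v 1) 5 = (leafMarkStar3MarkA a b c d + leafMarkStar3MarkB a b c d + leafMarkStar3MarkC a b c d + leafMarkStar3MarkD a b c d + leafMarkStar3MarkE a b c d + leafMarkStar3MarkF a b c d + leafMarkStar3MarkG a b c d + leafMarkStar3MarkH a b c d) 5 := by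
  simp only [leafMarkStar3MarkA, leafMarkStar3MarkB, leafMarkStar3MarkC, leafMarkStar3MarkD, leafMarkStar3MarkE, leafMarkStar3MarkF, leafMarkStar3MarkG, leafMarkStar3MarkH, leafMarkStar3MarkA1, leafMarkStar3MarkA2, leafMarkStar3MarkA3, leafMarkStar3MarkA4, leafMarkStar3MarkB1, leafMarkStar3MarkB2, leafMarkStar3MarkB3, leafMarkStar3MarkB4, leafMarkStar3MarkC1, leafMarkStar3MarkC2, leafMarkStar3MarkC3, leafMarkStar3MarkC4, leafMarkStar3MarkC5, leafMarkStar3MarkC6, leafMarkStar3MarkC7, leafMarkStar3MarkC8, leafMarkStar3MarkD1, leafMarkStar3MarkD2, leafMarkStar3MarkD3, leafMarkStar3MarkD4, leafMarkStar3MarkE1, leafMarkStar3MarkE2, leafMarkStar3MarkE3, leafMarkStar3MarkE4, leafMarkStar3MarkE5, leafMarkStar3MarkE6, leafMarkStar3MarkF1, leafMarkStar3MarkF2, leafMarkStar3MarkF3, leafMarkStar3MarkF4, leafMarkStar3MarkF5, leafMarkStar3MarkF6, leafMarkStar3MarkF7, leafMarkStar3MarkF8, leafMarkStar3MarkG1,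 leafMarkStar3MarkG2, leafMarkStar3MarkG3, leafMarkStar3MarkG4, leafMarkStar3MarkG5, leafMarkStar3MarkG6, leafMarkStar3MarkG7, leafMarkStar3MarkG8, leafMarkStar3MarkH1, leafMarkStar3MarkH2, leafMarkStar3MarkH3, leafMarkStar3MarkH4, leafMarkStar3MarkH5, leafMarkStar3MarkH6, thetaTri_eq_vec, Pi.add_apply, Pi.smul_apply, Pi.mul_apply, Pi.one_apply, smul_eq_mul, v]
  simp
  ring

end RelaxedTriangle

end PercRepro
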